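import Literature.NumberTheory.Sieve.HeathBrownCubicTwistedCauchy
import HarnessLib

/-!
# Heath-Brown's Lemma 3.10 for a twisted weight `w(β̂) F_β`: Lemma 12.1 (localisation into hypercubes)

D. R. Heath-Brown, *Primes represented by `x³ + 2y³`*, Acta Math. 186 (2001), §12 pp. 72–73 and
Lemma 12.1, for the twisted weight `w(β̂)F_β` (`|w| ≤ 1`) of Heath-Brown–Moroz 2004, Prop. 4.2 (ii):
the tree's `HeathBrownCubicTypeIILocalise` / `…S4Bound` (first theorem) re-run word for word.
PROVED: Class 0 cells contribute nothing to `S₅(w)`; on a Class I cell `S₅(w) = S₆(w)`; on any cell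
`|S₅(w)| ≤ (81/2)(S₇ + S₇')` (the UNtwisted divisor majorant, ready for Lemma 11.1); and
`S₄⁺(w) = ∑_{pairs of hypercubes} ∑_{t Class I} S₆(w) + ∑_{Class II cells} S₅(w)`.

## References

* D. R. Heath-Brown, Acta Math. 186 (2001), §12, Lemma 12.1. [cite: HeathBrownActa2001, Lemma 12.1]
* D. R. Heath-Brown, B. Z. Moroz, Proc. London Math. Soc. 88 (2004), Prop. 4.2. [cite: HeathBrownMoroz2004, Proposition 4.2]

## Mathlib / tree search

Tree: `HeathBrownCubicTypeIILocalise` (`PP`, `S5`, `S6`, `cellOf`, `ClassI`, `Class0`, `witnesses_of_PP`,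
`S5_eq_S6_of_classI`, `abs_S5_le_S7`), `HeathBrownCubicTypeIIS4Bound` (`S4plus_eq_classI_add_classII`).
-/

noncomputable section

open Finset NumberField

namespace Literature.NumberTheory.Sieve.CubicSieve.Twisted

open LFunctions.CubeRootTwoField CubicPrimes CubicSieve

variable {X η τ V T : ℝ} {k : ℕ} {m : Fin k → ℕ} {w : ℤ × ℤ × ℤ → ℝ} {N : ℕ} {Δ₀ : ℝ}

open scoped Classical in
/-- **Class 0 hypercubes contribute nothing to `S₅(w)`** (same index set as the tree's `S₅`).
[cite: HeathBrownActa2001, §12 p. 73] -/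
theorem S5_eq_zero_of_class0 (hX : 0 < X) (hη1 : η ≤ 1) (hT : 0 < T) (hTV : T ^ 3 = V) (hN : 0 < N)
    {t : ℕ} {n n' : ℤ × ℤ × ℤ} (h0 : Class0 X η T V N t n n') :
    S5 X η τ m V T w N Δ₀ (t, n, n') = 0 := by
  classical
  rw [S5]
  refine sum_eq_zero fun bb hbb => ?_
  exfalso
  rw [mem_filter] at hbb
  obtain ⟨hPP, hcell⟩ := hbb
  rw [cellOf, Prod.ext_iff, Prod.ext_iff] at hcell
  obtain ⟨ht, hn, hn'⟩ := hcell
  simp only at ht hn hn'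
  obtain ⟨c1, c2, hD, g1, g2, hR⟩ := witnesses_of_PP hX hη1 hT hTV hN hPP
  rw [hn] at c1; rw [hn'] at c2; rw [ht] at hD
  exact h0 _ c1 _ c2 _ hD ⟨g1, g2, hR⟩

open scoped Classical in
/-- **On a Class I hypercube `S₅(w) = S₆(w)`** (every lattice pair of `C₁ × C₂` with primitive coordinates
and `D` in the cell satisfies `ℛ_D`, is in the window with `V < N ≤ 2V`, so `F_{β_i} = f_{(β_i)}` and
`wF = wf`). [cite: HeathBrownActa2001, Lemma 12.1] -/
theorem S5_eq_S6_of_classI (hX : 0 < X) (hT : 0 < T) (hTV : T ^ 3 = V) (hN : 0 < N)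
    {t : ℕ} {n n' : ℤ × ℤ × ℤ} (hI : ClassI X η T V N t n n') :
    S5 X η τ m V T w N Δ₀ (t, n, n') = S6 X τ m T w N Δ₀ t n n' := by
  classical
  have hNR : (0 : ℝ) < N := by exact_mod_cast hN
  have hs : 0 < T / N := by positivity
  have hnn' : n ≠ n' := ne_of_classI hX hT.le hI
  set Q := (LC (T / N) n ×ˢ LC (T / N) n').filter (fun bb => IsPrimitiveVec bb.1 ∧ IsPrimitiveVec bb.2 ∧
      Δ₀ < (Dhcf bb : ℝ) ∧ tIdx N (Dhcf bb) = t) with hQ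
  have hQfacts : ∀ bb ∈ Q, bb.1 ∈ LC (T / N) n ∧ bb.2 ∈ LC (T / N) n' ∧ IsPrimitiveVec bb.1 ∧ IsPrimitiveVec bb.2 ∧
      Δ₀ < (Dhcf bb : ℝ) ∧ tIdx N (Dhcf bb) = t ∧ GoodB T V (castVec bb.1) ∧ GoodB T V (castVec bb.2) ∧
      bb.1 ≠ bb.2 ∧ cross3 bb.1 bb.2 ≠ 0 ∧ (Wab X η (aplus bb) bb.1 ∧ Wab X η (aplus bb) bb.2) := by
    intro bb hbb
    rw [hQ, mem_filter, mem_product] at hbb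
    obtain ⟨⟨hb1, hb2⟩, hp1, hp2, hD, ht⟩ := hbb
    have c1 := castVec_mem_realCell hs hb1
    have c2 := castVec_mem_realCell hs hb2
    obtain ⟨g1, g2, hR⟩ := hI _ c1 _ c2
    have hne : bb.1 ≠ bb.2 := by
      intro h
      rw [mem_LC_iff hs] at hb1 hb2
      exact hnn' (hb1.symm.trans (h ▸ hb2))
    have hpos1 : 0 < ell (castVec bb.1) := lt_trans hT g1.1.1
    have hpos2 : 0 < ell (castVec bb.2) := lt_trans hT g2.1.1
    have hv : cross3 bb.1 bb.2 ≠ 0 := cross3_ne_zero_of_ne hp1 hp2 hne hpos1 hpos2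
    have hDr : (Dhcf bb : ℝ) ∈ Drange N t := mem_Drange_of_tIdx hN (one_le_hcf3 hv) ht
    have hRD := hR _ hDr
    rw [RDR_castVec_iff] at hRD
    exact ⟨hb1, hb2, hp1, hp2, hD, ht, g1, g2, hne, hv, (Wplus_iff_RDplus hX.le hv).mpr hRD⟩
  -- `F = f` on `Q`, hence `wF = wf`
  have hFf : ∀ bb ∈ Q, CubicSieve.Fb X τ m V T bb.1 = fWeight X τ m (Ideal.span {coordElt bb.1}) ∧
      CubicSieve.Fb X τ m V T bb.2 = fWeight X τ m (Ideal.span {coordElt bb.2}) := by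
    intro bb hbb
    obtain ⟨-, -, hp1, hp2, -, -, g1, g2, -, -, -⟩ := hQfacts bb hbb
    have key : ∀ b, IsPrimitiveVec b → GoodB T V (castVec b) →
        CubicSieve.Fb X τ m V T b = fWeight X τ m (Ideal.span {coordElt b}) := by
      intro b hp hg
      have hw' := window_of_goodB hg
      have hN' := (goodB_castVec_iff (V := V) hT hw').mp hg
      rw [CubicSieve.Fb, if_pos ⟨hw', hp⟩, gCut, if_pos hN']
    exact ⟨key _ hp1 g1, key _ hp2 g2⟩
  have hset : (PP X η τ m V T Δ₀).filter (fun bb => cellOf N (T / N) bb = (t, n, n')) =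
      Q.filter (fun bb => CubicSieve.Fb X τ m V T bb.1 ≠ 0 ∧ CubicSieve.Fb X τ m V T bb.2 ≠ 0) := by
    ext bb
    rw [mem_filter, mem_filter]
    constructor
    · rintro ⟨hPP, hcell⟩
      obtain ⟨hoff, hD, hW, hF1, hF2, -⟩ := PP_facts hX hT hTV hPP
      rw [cellOf, Prod.ext_iff, Prod.ext_iff] at hcell
      obtain ⟨ht, hn, hn'⟩ := hcell
      simp only at ht hn hn'
      obtain ⟨-, hp1, -⟩ := CubicSieve.support_of_Fb_ne_zero hF1
      obtain ⟨-, hp2, -⟩ := CubicSieve.support_of_Fb_ne_zero hF2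
      refine ⟨?_, hF1, hF2⟩
      rw [hQ, mem_filter, mem_product, mem_LC_iff hs, mem_LC_iff hs]
      exact ⟨⟨hn, hn'⟩, hp1, hp2, hD, ht⟩
    · rintro ⟨hbb, hF1, hF2⟩
      obtain ⟨hb1, hb2, -, -, hD, ht, -, -, hne, -, hW⟩ := hQfacts bb hbb
      obtain ⟨hw1, -, hN1⟩ := CubicSieve.support_of_Fb_ne_zero hF1
      obtain ⟨hw2, -, hN2⟩ := CubicSieve.support_of_Fb_ne_zero hF2
      have hB : ∀ b, InWindow T (coordElt b) → (Ideal.absNorm (Ideal.span {coordElt b}) : ℝ) ≤ 2 * V →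
          b ∈ Bbox T := by
        intro b hw' hN2'
        have hNb := absNorm_eq_normForm_of_inWindow hT hw'
        have hell1 : T < ell (castVec b) := by have := hw'.1; rwa [ellO_coordElt] at this
        have hell2 : ell (castVec b) ≤ unitE * T := by have := hw'.2; rwa [ellO_coordElt] at this
        obtain ⟨a1, a2, a3⟩ := abs_coord_le_of_inWindow hT hTV hell1 hell2 (by rw [← hNb]; exact hN2')
        exact mem_cube_of_abs_le a1 a2 a3
      refine ⟨?_, ?_⟩
      · rw [PP, mem_filter, mem_offDiag]
        exact ⟨⟨hB _ hw1 hN1.2, hB _ hw2 hN2.2, hne⟩, hD, hW, hF1, hF2⟩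
      · rw [cellOf, ht, (mem_LC_iff hs).mp hb1, (mem_LC_iff hs).mp hb2]
  have hvan : ∀ bb ∈ Q, Fb X τ m V T w bb.1 * Fb X τ m V T w bb.2 ≠ 0 →
      CubicSieve.Fb X τ m V T bb.1 ≠ 0 ∧ CubicSieve.Fb X τ m V T bb.2 ≠ 0 := fun bb _ hne =>
    ⟨Fb_ne_zero_of_ne_zero (mul_ne_zero_iff.mp hne).1, Fb_ne_zero_of_ne_zero (mul_ne_zero_iff.mp hne).2⟩
  rw [S5, hset, sum_filter_of_ne hvan, S6, ← hQ]
  exact sum_congr rfl fun bb hbb => by rw [Fb_def, Fb_def, (hFf bb hbb).1, (hFf bb hbb).2]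

open scoped Classical in
/-- **The trivial bound for a hypercube**, twisted: `|S₅(w; t, C₁, C₂)| ≤ (81/2)(S₇ + S₇')` with the tree's
(untwisted) divisor majorants `S₇`. [cite: HeathBrownActa2001, Lemma 12.1] -/
theorem abs_S5_le_S7 (hw : ∀ b, |w b| ≤ 1) (hX : 1 < X) (hη1 : η ≤ 1) (hτ : 0 < τ) (hτ1 : τ ≤ 1) {nn : ℕ}
    {m : Fin (nn + 1) → ℕ} (hm : CoreAdmissible τ m) (hT : 0 < T) (hTV : T ^ 3 = V) (hN : 0 < N) (t : ℕ)
    (n n' : ℤ × ℤ × ℤ) :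
    |S5 X η τ m V T w N Δ₀ (t, n, n')| ≤ (81 / 2) *
      ((∑ D ∈ Dset X V N Δ₀ t, ∑ b₁ ∈ (LC (T / N) n).filter IsPrimitiveVec,
          ∑ _b₂ ∈ (LC (T / N) n').filter (fun b₂ => DvdVec (D : ℤ) (cross3 b₁ b₂)),
            (idealDivisorCount (Ideal.span {coordElt b₁}) : ℝ) ^ 2) +
        (∑ D ∈ Dset X V N Δ₀ t, ∑ b₂ ∈ (LC (T / N) n').filter IsPrimitiveVec,
          ∑ _b₁ ∈ (LC (T / N) n).filter (fun b₁ => DvdVec (D : ℤ) (cross3 b₂ b₁)),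
            (idealDivisorCount (Ideal.span {coordElt b₂}) : ℝ) ^ 2)) := by
  classical
  have hX0 : 0 < X := by linarith
  have hNR : (0 : ℝ) < N := by exact_mod_cast hN
  set s : ℝ := T / N with hs
  have hs0 : 0 < s := by rw [hs]; positivity
  set Q' := (LC s n ×ˢ LC s n').filter (fun bb => IsPrimitiveVec bb.1 ∧ IsPrimitiveVec bb.2 ∧
      Dhcf bb ∈ Dset X V N Δ₀ t) with hQ'
  set τ₁ : (ℤ × ℤ × ℤ) × (ℤ × ℤ × ℤ) → ℝ := fun bb => (idealDivisorCount (Ideal.span {coordElt bb.1}) : ℝ) ^ 2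
    with hτ₁
  set τ₂ : (ℤ × ℤ × ℤ) × (ℤ × ℤ × ℤ) → ℝ := fun bb => (idealDivisorCount (Ideal.span {coordElt bb.2}) : ℝ) ^ 2
    with hτ₂
  have hsub : (PP X η τ m V T Δ₀).filter (fun bb => cellOf N s bb = (t, n, n')) ⊆ Q' := by
    intro bb hbb
    rw [mem_filter] at hbb
    obtain ⟨hPP, hcell⟩ := hbb
    obtain ⟨hoff, hD, hW, hF1, hF2, hDmax⟩ := PP_facts hX0 hT hTV hPP
    rw [cellOf, Prod.ext_iff, Prod.ext_iff] at hcell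
    obtain ⟨ht, hn, hn'⟩ := hcell
    simp only at ht hn hn'
    obtain ⟨-, hp1, -⟩ := CubicSieve.support_of_Fb_ne_zero hF1
    obtain ⟨-, hp2, -⟩ := CubicSieve.support_of_Fb_ne_zero hF2
    have hne : bb.1 ≠ bb.2 := (mem_offDiag.mp hoff).2.2
    have hv : cross3 bb.1 bb.2 ≠ 0 := cross3_ne_zero_of_Wab hX0.le hη1 hp1 hne hW.1 hW.2
    rw [hQ', mem_filter, mem_product]
    refine ⟨?_, hp1, hp2, ?_⟩
    · rw [mem_LC_iff hs0, mem_LC_iff hs0]; exact ⟨hn, hn'⟩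
    · rw [Dset, mem_filter, mem_Icc]
      exact ⟨⟨one_le_hcf3 hv, Nat.le_floor hDmax⟩, hD, ht⟩
  have h1 : |S5 X η τ m V T w N Δ₀ (t, n, n')| ≤ ∑ bb ∈ Q', (81 / 2) * (τ₁ bb + τ₂ bb) := by
    rw [S5, ← hs]
    refine (abs_sum_le_sum_abs _ _).trans ?_
    refine (sum_le_sum_of_subset_of_nonneg hsub (fun _ _ _ => abs_nonneg _)).trans (sum_le_sum fun bb _ => ?_)
    rw [abs_mul]
    have e1 := Fb_sq_le (V := V) (T := T) hw hX hτ hτ1 hm bb.1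
    have e2 := Fb_sq_le (V := V) (T := T) hw hX hτ hτ1 hm bb.2
    simp only [hτ₁, hτ₂]
    nlinarith [sq_nonneg (|Fb X τ m V T w bb.1| - |Fb X τ m V T w bb.2|), sq_abs (Fb X τ m V T w bb.1),
      sq_abs (Fb X τ m V T w bb.2), abs_nonneg (Fb X τ m V T w bb.1), abs_nonneg (Fb X τ m V T w bb.2)]
  refine h1.trans ?_
  rw [← mul_sum, sum_add_distrib]
  refine mul_le_mul_of_nonneg_left (add_le_add ?_ ?_) (by norm_num)
  · rw [← sum_fiberwise_of_maps_to (g := fun bb => Dhcf bb) (t := Dset X V N Δ₀ t)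
      (fun bb hbb => by rw [hQ', mem_filter] at hbb; exact hbb.2.2.2)]
    refine sum_le_sum fun D hD => ?_
    calc ∑ bb ∈ Q'.filter (fun bb => Dhcf bb = D), τ₁ bb
        ≤ ∑ bb ∈ (LC s n ×ˢ LC s n').filter (fun bb => IsPrimitiveVec bb.1 ∧ DvdVec (D : ℤ) (cross3 bb.1 bb.2)),
            τ₁ bb := by
          refine sum_le_sum_of_subset_of_nonneg (fun bb hbb => ?_) (fun _ _ _ => by positivity)
          rw [mem_filter, hQ', mem_filter] at hbb
          obtain ⟨⟨hprod, hp1, -, -⟩, hDeq⟩ := hbb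
          rw [mem_filter]
          refine ⟨hprod, hp1, ?_⟩
          rw [← hDeq]; exact hcf3_dvd _
      _ = _ := by
          rw [sum_filter, sum_product, sum_filter]
          refine sum_congr rfl fun b₁ _ => ?_
          by_cases hp : IsPrimitiveVec b₁
          · rw [if_pos hp, sum_filter]
            refine sum_congr rfl fun b₂ _ => ?_
            simp only [hp, true_and, hτ₁]
          · rw [if_neg hp]
            exact sum_eq_zero fun b₂ _ => if_neg (fun h => hp h.1)
  · rw [← sum_fiberwise_of_maps_to (g := fun bb => Dhcf bb) (t := Dset X V N Δ₀ t)
      (fun bb hbb => by rw [hQ', mem_filter] at hbb; exact hbb.2.2.2)]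
    refine sum_le_sum fun D hD => ?_
    calc ∑ bb ∈ Q'.filter (fun bb => Dhcf bb = D), τ₂ bb
        ≤ ∑ bb ∈ (LC s n ×ˢ LC s n').filter (fun bb => IsPrimitiveVec bb.2 ∧ DvdVec (D : ℤ) (cross3 bb.2 bb.1)),
            τ₂ bb := by
          refine sum_le_sum_of_subset_of_nonneg (fun bb hbb => ?_) (fun _ _ _ => by positivity)
          rw [mem_filter, hQ', mem_filter] at hbb
          obtain ⟨⟨hprod, -, hp2, -⟩, hDeq⟩ := hbb
          rw [mem_filter]
          refine ⟨hprod, hp2, ?_⟩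
          rw [← hDeq, cross3_swap]
          obtain ⟨d1, d2, d3⟩ : DvdVec (Dhcf bb : ℤ) (cross3 bb.1 bb.2) := hcf3_dvd _
          refine ⟨?_, ?_, ?_⟩ <;> simp only [Prod.fst_neg, Prod.snd_neg, dvd_neg] <;> assumption
      _ = _ := by
          rw [sum_filter, sum_product_right, sum_filter]
          refine sum_congr rfl fun b₂ _ => ?_
          by_cases hp : IsPrimitiveVec b₂
          · rw [if_pos hp, sum_filter]
            refine sum_congr rfl fun b₁ _ => ?_
            simp only [hp, true_and, hτ₂]
          · rw [if_neg hp]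
            exact sum_eq_zero fun b₁ _ => if_neg (fun h => hp h.1)

open scoped Classical in
/-- **`S₄⁺(w) = ∑_{(𝐧,𝐧')} ∑_{t Class I} S₆(w) + ∑_{Class II cells} S₅(w)`** (Class 0 cells vanish).
[cite: HeathBrownActa2001, Lemma 12.1] -/
theorem S4plus_eq_classI_add_classII (hX : 0 < X) (hη1 : η ≤ 1) (hT : 0 < T) (hTV : T ^ 3 = V) (hN : 0 < N)
    (hΔ : 1 ≤ Δ₀) :
    S4plus X η τ m V T w Δ₀ =
      ∑ nn ∈ Nrange N ×ˢ Nrange N, classISum X η τ m V T w N Δ₀ nn.1 nn.2 +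
      ∑ c ∈ (Trange N Δ₀ (270 * V / X) ×ˢ (Nrange N ×ˢ Nrange N)).filter
          (fun c => ¬ ClassI X η T V N c.1 c.2.1 c.2.2 ∧ ¬ Class0 X η T V N c.1 c.2.1 c.2.2),
        S5 X η τ m V T w N Δ₀ c := by
  classical
  rw [S4plus_eq_sum_S5 hX hT hTV hN hΔ]
  set TR := Trange N Δ₀ (270 * V / X) with hTR
  set NN := Nrange N ×ˢ Nrange N with hNN
  rw [← sum_filter_add_sum_filter_not (TR ×ˢ NN) (fun c => ClassI X η T V N c.1 c.2.1 c.2.2)]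
  congr 1
  · calc ∑ c ∈ (TR ×ˢ NN).filter (fun c => ClassI X η T V N c.1 c.2.1 c.2.2), S5 X η τ m V T w N Δ₀ c
        = ∑ c ∈ (TR ×ˢ NN).filter (fun c => ClassI X η T V N c.1 c.2.1 c.2.2),
            S6 X τ m T w N Δ₀ c.1 c.2.1 c.2.2 := by
          refine sum_congr rfl fun c hc => ?_
          rw [mem_filter] at hc
          have := S5_eq_S6_of_classI (τ := τ) (m := m) (w := w) (Δ₀ := Δ₀) hX hT hTV hN hc.2
          rw [← this]
      _ = ∑ c ∈ TR ×ˢ NN, (if ClassI X η T V N c.1 c.2.1 c.2.2 then S6 X τ m T w N Δ₀ c.1 c.2.1 c.2.2 else 0) := by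
          rw [sum_filter]
      _ = ∑ nn ∈ NN, ∑ t ∈ TR, (if ClassI X η T V N t nn.1 nn.2 then S6 X τ m T w N Δ₀ t nn.1 nn.2 else 0) := by
          rw [sum_product_right]
      _ = ∑ nn ∈ NN, classISum X η τ m V T w N Δ₀ nn.1 nn.2 := by
          refine sum_congr rfl fun nn _ => ?_
          rw [classISum, TI, sum_filter]
  · rw [← sum_filter_add_sum_filter_not ((TR ×ˢ NN).filter (fun c => ¬ClassI X η T V N c.1 c.2.1 c.2.2))
      (fun c => Class0 X η T V N c.1 c.2.1 c.2.2)]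
    have h0 : ∑ c ∈ ((TR ×ˢ NN).filter (fun c => ¬ClassI X η T V N c.1 c.2.1 c.2.2)).filter
        (fun c => Class0 X η T V N c.1 c.2.1 c.2.2), S5 X η τ m V T w N Δ₀ c = 0 := by
      refine sum_eq_zero fun c hc => ?_
      rw [mem_filter] at hc
      have := S5_eq_zero_of_class0 (τ := τ) (m := m) (w := w) (Δ₀ := Δ₀) hX hη1 hT hTV hN hc.2
      rw [← this]
    rw [h0, zero_add, filter_filter]

end Literature.NumberTheory.Sieve.CubicSieve.Twisted

end
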